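import Literature.MathematicalPhysics.QuantumFieldTheory.Balaban1983to89.B6HolderPairGeometryV1
import Literature.MathematicalPhysics.QuantumFieldTheory.Balaban1983to89.B6KLevelCensusIndexV1

/-!
# `Balaban1983to89.B9Eq340NearPairBlocks` — T. Bałaban, *Propagators for lattice gauge theories in a background field*, Commun. Math. Phys. **99** (1985) 389–434
# [Balaban1985BackgroundPropagators], (3.40) p. 397 («x, x′ ∈ Δ̃(y), |x − x′| ≦ 1») with [4] (2.46) p. 231: AT A k-LEVEL INDEX `i : KIdx`, THE OUTPUT BLOCK OF ANY BOND WITHIN THE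
# ADMISSIBLE RADIUS `L^{j(y(x))}` OF A BOND `x` IS `d_T`-CLOSE TO `y(x)` AND ITS LEVEL DIFFERS BY AT MOST ONE — p22's window geometry (`B6HolderPairGeometryV1.pair_levels ∕
# pair_distT_le`) packaged hypothesis-free at the index (the cube `□` with `h_□(x) ≠ 0` is found inside), for the contour bookkeeping of the N06 Hölder probes

statement-level skeleton of published theorems with citation tags; proofs where landed; nothing here is a claim about the Yang–Mills mass gap

THE PRINT.  [B9] (3.40) p. 397 (the covariant Hölder quotient over pairs `x, x′ ∈ Δ̃(y)`, *"a shortest contour Γ_{x,x′}"*); [4] = T. Bałaban, *Propagators and renormalization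
transformations for lattice gauge theories. II*, Commun. Math. Phys. **96** (1984) 223–250 [Balaban1984PropagatorsII], (2.46) p. 231 (the multiscale distance `d(y, y′)`), p. 231–232
(*"d(x, x′) = d(y, y′) if x ∈ B^j(y), x′ ∈ B^{j′}(y′)"*), Prop. 2.6 (2.137) p. 247.

WHY THIS FILE (cell `pub-ymgap`, Track A node N06 [B9], WIDTH-209 piece 1 = W-c, face `hX = Thm33G0DirX`, seat `pub-ymgap-dag-n06-w6`).  The zeroth-order Hölder probe `pX0`
(Φ^X_β∘G₀ : 𝔠⁽⁰⁾ → 𝔠_P^{(β−2)}) is assembled from the sup bounds (3.42)₁,₂ of `G₀`, `∇_U G₀` along the taxicab contour `Γ_{x,x′}` (`B9Eq340TaxiTelescope`: the contour stays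
within `|x − x′|_∞` of `x`); the sup bound at a rung bond `b` is indexed by ITS block `y(b)` and scale `L^{j(y(b))}η`, so the assembly needs, for every bond within the
admissible radius of `x`: `d_T(y(x), y(b)) ≤ O(1)` (to move `e^{−δ₀ d(y(b), y′)}` to `e^{−δ₀ d(y(x), y′)}`) and `|j(y(x)) − j(y(b))| ≤ 1` (to compare the scale factors).
p22 ∕ p38 proved exactly this for ACTIVE near pairs relative to a census cube (`pair_levels`, `pair_distT_le`, hypotheses `h_□ ≠ 0`, `|x − x′|_∞ ≤ L^{j₀(□)+1}`);
THIS FILE removes the cube from the statement at an index `i : KIdx` (every bond is active for some cube by (2.36) `Σ_□ h_□² = 1`; `j(y(x)) ≤ j₀(□) + 1`).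

WHAT IS PROVED (sorry-free; theorems only).
* `exists_hB_ne_zero` — some cube is active at any bond ((2.36), as in p22's private lemma).
* ★★ `near_levels` — `|x − x′|_∞ ≤ L^{j(y(x))}` ⟹ `j(y(x′)) ≤ j(y(x)) + 1 ∧ j(y(x)) ≤ j(y(x′)) + 1`.
* ★★ `near_distT_le` — `|x − x′|_∞ ≤ L^{j(y(x))}` ⟹ `d_T(y(x), y(x′)) ≤ (d+1)(L+1)`.
* ★ `near_len_le` — the scale lengths compare: `L^{j(y(x′))} ≤ L·L^{j(y(x))}` and `L^{j(y(x))} ≤ L·L^{j(y(x′))}`.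
* ★ `near_exp_le` — the kernel moves: `e^{−δ d_T(y(x′), w)} ≤ e^{δ(d+1)(L+1)}·e^{−δ d_T(y(x), w)}` for `δ ≥ 0` and every block `w` (triangle inequality of `d_T`).
* at the CARRIER blocks of the N06 readings (`kGeo i`, carrier map `bI` with the certificate's pins `hβ1 : d_T(β(bI x), y(x)) ≤ 1`, `hlev : lvl(bI x) = j(y(x))`):
  `distT_comm`, ★★ `near_dist_carrier_le` (`d(bI x, bI x′) ≤ (d+1)(L+1) + 2`), ★ `near_len_carrier_le` (`len(bI x′) ≤ L·len(bI x)` and conversely),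
  ★ `near_exp_carrier_le` (`e^{−δ d(bI x′, w)} ≤ e^{δ((d+1)(L+1)+2)}·e^{−δ d(bI x, w)}`).

HONEST SCOPE.  A thin hypothesis-free repackaging of p22's (G1)–(G2) at the index; the constants `(d+1)(L+1)`, `L` are the tree's, not print's; nothing of [B9] ∕ [4] asserted;
COUNT-NEUTRAL; N06 NOT discharged; one finite torus at a time; nothing continuum, nothing about the mass gap.  Cell `pub-ymgap` (HUMAN RULING D-0062), Track A node N06 [B9],
seat `pub-ymgap-dag-n06-w6` (g0), 2026-08-28; a NEW file.
-/

namespace Literature.MathematicalPhysics.QuantumFieldTheory.Balaban1983to89.B9Eq340NearPairBlocks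

open LatticeFieldCalculus (supDist)
open B6MultiLevelBoxOperator (N0)
open B6MultiLevelTorusOperator (TDomains)
open B6Cover236MultiLevelBlocks (cubes)
open B6Geom246MultiLevelTorus (geomT bondT triangle_refl_nonneg_T)
open B6GlobalChartV1 (PV blkV1 domT)
open B6SectAOperatorsV1 (BondIdx)
open B6Ineq2142KLevelV1 (β lvl)
open B6Prop26KLevelSkeletonV1 (hB sum_hB_sq)
open B6CubeWindowV1 (j0)
open B6HolderPairGeometryV1 (pair_levels pair_distT_le)
open B6KLevelCensusIndexV1 (KIdx kGeo len_eq)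

noncomputable section

variable {d ℓ : ℕ} {hd : 1 ≤ d + 1} {hL : Odd (ℓ + 1) ∧ 1 < ℓ + 1} {b₀ b₁ : ℝ}

/-- every fine bond is ACTIVE for some cube: `Σ_□ h_□(x)² = 1` forces `h_□(x) ≠ 0` for some `□` (p22's private lemma, at an index).
[cite: Balaban1984PropagatorsII, (2.36) p.229] -/
theorem exists_hB_ne_zero (i : KIdx d ℓ hd hL b₀ b₁) (x : PBond (PV d ℓ i.m i.K hd hL) 0) :
    ∃ c : ↥(cubes i.D.toDomains), hB i.hN i.D c x ≠ 0 := by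
  by_contra hno
  simp only [not_exists, ne_eq, not_not] at hno
  have hMh1 : 1 ≤ i.Mh := le_trans (by norm_num) i.hM8
  have hP : ∀ μ, 1 ≤ i.P' μ := fun μ => le_trans (by norm_num) (i.hP5 μ)
  have h := sum_hB_sq i.hN i.D hMh1 hP x
  have h0 : ∑ c ∈ Finset.univ, hB i.hN i.D c x ^ 2 = 0 := Finset.sum_eq_zero fun c _ => by rw [hno c]; ring
  linarith

/-- the window data of the cube carrying `x`: `j₀(□) ≤ j(y(x)) ≤ j₀(□) + 1`, and a near partner `x′` (`|x − x′|_∞ ≤ L^{j(y(x))}`) is within the admissible radius `L^{j₀(□)+1}`.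
[cite: Balaban1984PropagatorsII, (2.36) p.229, Prop. 2.6 (2.137) p.247; Balaban1985BackgroundPropagators, (3.40) p.397] -/
theorem near_window (i : KIdx d ℓ hd hL b₀ b₁) {x x' : PBond (PV d ℓ i.m i.K hd hL) 0} {c : ↥(cubes i.D.toDomains)} (hc : hB i.hN i.D c x ≠ 0)
    (hnear : supDist x.src x'.src ≤ (ℓ + 1) ^ (blkV1 i.hN i.D x).1.1) :
    (j0 (D := i.D) (le_trans (by norm_num) i.hM8) (fun μ => le_trans (by norm_num) (i.hP5 μ)) c ≤ (blkV1 i.hN i.D x).1.1 ∧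
      (blkV1 i.hN i.D x).1.1 ≤ j0 (D := i.D) (le_trans (by norm_num) i.hM8) (fun μ => le_trans (by norm_num) (i.hP5 μ)) c + 1) ∧
      supDist x.src x'.src ≤ (ℓ + 1) ^ (j0 (D := i.D) (le_trans (by norm_num) i.hM8) (fun μ => le_trans (by norm_num) (i.hP5 μ)) c + 1) := by
  have hself : supDist x.src x.src ≤ (ℓ + 1) ^ (j0 (D := i.D) (le_trans (by norm_num) i.hM8) (fun μ => le_trans (by norm_num) (i.hP5 μ)) c + 1) := by
    rw [(B3TorusRadialSums.supDist_eq_zero_iff x.src x.src).2 rfl]; exact Nat.zero_le _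
  have hlevx := (pair_levels i.hN i.D i.hk (hMh1 := le_trans (by norm_num) i.hM8) (hP4 := fun μ => le_trans (by norm_num) (i.hP5 μ)) i.hMha c i.hM8 i.hR2
    (i.hpl c) x.dir (x := x) (x' := x) (Or.inl hc) hself).1
  exact ⟨hlevx, hnear.trans (Nat.pow_le_pow_right (Nat.succ_pos ℓ) hlevx.2)⟩

/-- ★★ **NEAR BONDS HAVE NEIGHBOURING LEVELS**: if `|x − x′|_∞ ≤ L^{j(y(x))}` (def-Y's admissible radius at `x`) then `j(y(x′)) ≤ j(y(x)) + 1` and `j(y(x)) ≤ j(y(x′)) + 1`.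
[cite: Balaban1984PropagatorsII, Prop. 2.6 (2.137) p.247 (x, x′ ∈ Δ̃(y), y ∈ Λ_j), (2.2) p.224; Balaban1985BackgroundPropagators, (3.40) p.397] -/
theorem near_levels (i : KIdx d ℓ hd hL b₀ b₁) {x x' : PBond (PV d ℓ i.m i.K hd hL) 0} (hnear : supDist x.src x'.src ≤ (ℓ + 1) ^ (blkV1 i.hN i.D x).1.1) :
    (blkV1 i.hN i.D x').1.1 ≤ (blkV1 i.hN i.D x).1.1 + 1 ∧ (blkV1 i.hN i.D x).1.1 ≤ (blkV1 i.hN i.D x').1.1 + 1 := by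
  obtain ⟨c, hc⟩ := exists_hB_ne_zero i x
  obtain ⟨hlevx, hdist⟩ := near_window i hc hnear
  have hG1 := pair_levels i.hN i.D i.hk (hMh1 := le_trans (by norm_num) i.hM8) (hP4 := fun μ => le_trans (by norm_num) (i.hP5 μ)) i.hMha c i.hM8 i.hR2
    (i.hpl c) x.dir (x := x) (x' := x') (Or.inl hc) hdist
  omega

/-- ★★ **NEAR BONDS HAVE `d_T`-CLOSE OUTPUT BLOCKS**: if `|x − x′|_∞ ≤ L^{j(y(x))}` then `d_T(y(x), y(x′)) ≤ (d+1)(L+1)`.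
[cite: Balaban1984PropagatorsII, (2.46) p.231, p.231–232 («d(x, x′) = d(y, y′) if x ∈ B^j(y) …»), Prop. 2.6 (2.137) p.247; Balaban1985BackgroundPropagators, (3.40) p.397] -/
theorem near_distT_le (i : KIdx d ℓ hd hL b₀ b₁) {x x' : PBond (PV d ℓ i.m i.K hd hL) 0} (hnear : supDist x.src x'.src ≤ (ℓ + 1) ^ (blkV1 i.hN i.D x).1.1) :
    (geomT i.D).dist (blkV1 i.hN i.D x) (blkV1 i.hN i.D x') ≤ ((d : ℝ) + 1) * (((ℓ : ℝ) + 1) + 1) := by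
  obtain ⟨c, hc⟩ := exists_hB_ne_zero i x
  obtain ⟨-, hdist⟩ := near_window i hc hnear
  exact pair_distT_le i.hN i.D i.hk (hMh1 := le_trans (by norm_num) i.hM8) (hP4 := fun μ => le_trans (by norm_num) (i.hP5 μ)) i.hMha c i.hM8 i.hR2
    (i.hpl c) x.dir (x := x) (x' := x') (Or.inl hc) hdist

/-- ★ **THE SCALE LENGTHS OF NEAR BONDS COMPARE**: `L^{j(y(x′))} ≤ L·L^{j(y(x))}` and `L^{j(y(x))} ≤ L·L^{j(y(x′))}` (`geomT` lengths, `L = ℓ + 1`).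
[cite: Balaban1984PropagatorsII, (2.2) p.224, Prop. 2.6 (2.137) p.247; Balaban1985BackgroundPropagators, (3.41) p.397] -/
theorem near_len_le (i : KIdx d ℓ hd hL b₀ b₁) {x x' : PBond (PV d ℓ i.m i.K hd hL) 0} (hnear : supDist x.src x'.src ≤ (ℓ + 1) ^ (blkV1 i.hN i.D x).1.1) :
    (geomT i.D).len (blkV1 i.hN i.D x') ≤ ((ℓ : ℝ) + 1) * (geomT i.D).len (blkV1 i.hN i.D x) ∧
      (geomT i.D).len (blkV1 i.hN i.D x) ≤ ((ℓ : ℝ) + 1) * (geomT i.D).len (blkV1 i.hN i.D x') := by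
  obtain ⟨h1, h2⟩ := near_levels i hnear
  have hL1 : (1 : ℝ) ≤ (ℓ : ℝ) + 1 := by linarith [(Nat.cast_nonneg ℓ : (0 : ℝ) ≤ ℓ)]
  have e : ∀ y : (geomT i.D).Site, (geomT i.D).len y = ((ℓ : ℝ) + 1) ^ y.1.1 * 1 := fun _ => rfl
  rw [e, e, mul_one, mul_one, ← pow_succ', ← pow_succ']
  exact ⟨pow_le_pow_right₀ hL1 h1, pow_le_pow_right₀ hL1 h2⟩

/-- ★ **THE KERNEL MOVES BETWEEN NEAR BONDS**: for `δ ≥ 0` and every block `w`, `e^{−δ d_T(y(x′), w)} ≤ e^{δ(d+1)(L+1)}·e^{−δ d_T(y(x), w)}` (triangle inequality and symmetry of `d_T`).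
[cite: Balaban1984PropagatorsII, (2.46)–(2.47) p.231, Prop. 2.6 (2.137) p.247; Balaban1985BackgroundPropagators, (3.40), (3.42) p.397] -/
theorem near_exp_le (i : KIdx d ℓ hd hL b₀ b₁) {x x' : PBond (PV d ℓ i.m i.K hd hL) 0} (hnear : supDist x.src x'.src ≤ (ℓ + 1) ^ (blkV1 i.hN i.D x).1.1)
    {δ : ℝ} (hδ : 0 ≤ δ) (w : (geomT i.D).Site) :
    Real.exp (-(δ * (geomT i.D).dist (blkV1 i.hN i.D x') w)) ≤
      Real.exp (δ * (((d : ℝ) + 1) * (((ℓ : ℝ) + 1) + 1))) * Real.exp (-(δ * (geomT i.D).dist (blkV1 i.hN i.D x) w)) := by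
  have hd := near_distT_le i hnear
  obtain ⟨htri, -, -⟩ := triangle_refl_nonneg_T i.D (le_trans (by norm_num) i.hM8) (fun μ => le_trans (by norm_num) (i.hP5 μ))
  rw [← Real.exp_add]
  refine Real.exp_le_exp.2 ?_
  have h1 := htri (blkV1 i.hN i.D x) (blkV1 i.hN i.D x') w
  have h2 : (geomT i.D).dist (blkV1 i.hN i.D x) (blkV1 i.hN i.D x') ≤ ((d : ℝ) + 1) * (((ℓ : ℝ) + 1) + 1) := hd
  nlinarith [mul_le_mul_of_nonneg_left h1 hδ, mul_le_mul_of_nonneg_left h2 hδ]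

/-! ## At the carrier blocks of the N06 readings (`kGeo i`: sites `BondIdx`, `d = d_T ∘ β`, `len = L^{lvl}·|c_f|⁻¹`) under the certificate's pins
`hβ1 : d_T(β(bI x), y(x)) ≤ 1` and `hlev : lvl(bI x) = j(y(x))` -/

/-- `d_T` is symmetric (a graph distance). [cite: Balaban1984PropagatorsII, (2.46) p.231] -/
theorem distT_comm (i : KIdx d ℓ hd hL b₀ b₁) (s t : (geomT i.D).Site) : (geomT i.D).dist s t = (geomT i.D).dist t s := by
  show (((bondT i.D).dist s t : ℕ) : ℝ) = (((bondT i.D).dist t s : ℕ) : ℝ)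
  rw [SimpleGraph.dist_comm]

/-- ★★ **NEAR BONDS HAVE `d`-CLOSE CARRIER BLOCKS**: under the 1-faithfulness pin `hβ1` of the carrier map `bI`, `|x − x′|_∞ ≤ L^{j(y(x))}` gives
`d(bI x, bI x′) ≤ (d+1)(L+1) + 2` in the reading geometry `kGeo i` (`d = d_T ∘ β`). [cite: Balaban1984PropagatorsII, (2.46) p.231, Prop. 2.6 (2.137) p.247; Balaban1985BackgroundPropagators, (3.40) p.397] -/
theorem near_dist_carrier_le (i : KIdx d ℓ hd hL b₀ b₁) {bI : PBond (PV d ℓ i.m i.K hd hL) 0 → BondIdx (domT i.hN i.D i.hk)}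
    (hβ1 : ∀ x : PBond (PV d ℓ i.m i.K hd hL) 0, (geomT i.D).dist (β i.hN i.D i.hk (bI x)) (blkV1 i.hN i.D x) ≤ 1)
    {x x' : PBond (PV d ℓ i.m i.K hd hL) 0} (hnear : supDist x.src x'.src ≤ (ℓ + 1) ^ (blkV1 i.hN i.D x).1.1) :
    (kGeo i).dist (bI x) (bI x') ≤ ((d : ℝ) + 1) * (((ℓ : ℝ) + 1) + 1) + 2 := by
  obtain ⟨htri, -, -⟩ := triangle_refl_nonneg_T i.D (le_trans (by norm_num) i.hM8) (fun μ => le_trans (by norm_num) (i.hP5 μ))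
  have hd := near_distT_le i hnear
  have h1 := hβ1 x
  have h2 : (geomT i.D).dist (blkV1 i.hN i.D x') (β i.hN i.D i.hk (bI x')) ≤ 1 := by rw [distT_comm]; exact hβ1 x'
  have t1 := htri (β i.hN i.D i.hk (bI x)) (blkV1 i.hN i.D x) (β i.hN i.D i.hk (bI x'))
  have t2 := htri (blkV1 i.hN i.D x) (blkV1 i.hN i.D x') (β i.hN i.D i.hk (bI x'))
  show (geomT i.D).dist (β i.hN i.D i.hk (bI x)) (β i.hN i.D i.hk (bI x')) ≤ _
  linarith

/-- ★ **THE READING LENGTHS OF NEAR BONDS COMPARE**: under the level pin `hlev`, `(L^{lvl}|c_f|⁻¹)(bI x′) ≤ L·(L^{lvl}|c_f|⁻¹)(bI x)` and conversely.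
[cite: Balaban1984PropagatorsII, (2.1)–(2.2) p.224, Prop. 2.6 (2.137) p.247; Balaban1985BackgroundPropagators, (3.41) p.397] -/
theorem near_len_carrier_le (i : KIdx d ℓ hd hL b₀ b₁) {bI : PBond (PV d ℓ i.m i.K hd hL) 0 → BondIdx (domT i.hN i.D i.hk)}
    (hlev : ∀ x : PBond (PV d ℓ i.m i.K hd hL) 0, lvl i.hN i.D i.hk (bI x) = (blkV1 i.hN i.D x).1.1)
    {x x' : PBond (PV d ℓ i.m i.K hd hL) 0} (hnear : supDist x.src x'.src ≤ (ℓ + 1) ^ (blkV1 i.hN i.D x).1.1) :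
    (kGeo i).len (bI x') ≤ ((ℓ : ℝ) + 1) * (kGeo i).len (bI x) ∧ (kGeo i).len (bI x) ≤ ((ℓ : ℝ) + 1) * (kGeo i).len (bI x') := by
  obtain ⟨h1, h2⟩ := near_levels i hnear
  have hL1 : (1 : ℝ) ≤ (ℓ : ℝ) + 1 := by linarith [(Nat.cast_nonneg ℓ : (0 : ℝ) ≤ ℓ)]
  have hc : 0 ≤ |i.cf|⁻¹ := inv_nonneg.mpr (abs_nonneg _)
  have hcast : (((ℓ + 1 : ℕ) : ℝ)) = (ℓ : ℝ) + 1 := by push_cast; ring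
  rw [len_eq, len_eq, hlev x, hlev x', hcast, div_eq_mul_inv, div_eq_mul_inv, ← mul_assoc, ← mul_assoc, ← pow_succ', ← pow_succ']
  exact ⟨mul_le_mul_of_nonneg_right (pow_le_pow_right₀ hL1 h1) hc, mul_le_mul_of_nonneg_right (pow_le_pow_right₀ hL1 h2) hc⟩

/-- ★ **THE READING KERNEL MOVES BETWEEN NEAR BONDS**: under `hβ1`, for `δ ≥ 0` and every carrier block `w`,
`e^{−δ d(bI x′, w)} ≤ e^{δ((d+1)(L+1)+2)}·e^{−δ d(bI x, w)}`. [cite: Balaban1984PropagatorsII, (2.46)–(2.47) p.231, (2.54) p.232; Balaban1985BackgroundPropagators, (3.42) p.397] -/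
theorem near_exp_carrier_le (i : KIdx d ℓ hd hL b₀ b₁) {bI : PBond (PV d ℓ i.m i.K hd hL) 0 → BondIdx (domT i.hN i.D i.hk)}
    (hβ1 : ∀ x : PBond (PV d ℓ i.m i.K hd hL) 0, (geomT i.D).dist (β i.hN i.D i.hk (bI x)) (blkV1 i.hN i.D x) ≤ 1)
    {x x' : PBond (PV d ℓ i.m i.K hd hL) 0} (hnear : supDist x.src x'.src ≤ (ℓ + 1) ^ (blkV1 i.hN i.D x).1.1)
    {δ : ℝ} (hδ : 0 ≤ δ) (w : BondIdx (domT i.hN i.D i.hk)) :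
    Real.exp (-(δ * (kGeo i).dist (bI x') w)) ≤
      Real.exp (δ * (((d : ℝ) + 1) * (((ℓ : ℝ) + 1) + 1) + 2)) * Real.exp (-(δ * (kGeo i).dist (bI x) w)) := by
  obtain ⟨htri, -, -⟩ := triangle_refl_nonneg_T i.D (le_trans (by norm_num) i.hM8) (fun μ => le_trans (by norm_num) (i.hP5 μ))
  have hd := near_dist_carrier_le i hβ1 hnear
  rw [← Real.exp_add]
  refine Real.exp_le_exp.2 ?_
  have t1 : (kGeo i).dist (bI x) w ≤ (kGeo i).dist (bI x) (bI x') + (kGeo i).dist (bI x') w :=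
    htri (β i.hN i.D i.hk (bI x)) (β i.hN i.D i.hk (bI x')) (β i.hN i.D i.hk w)
  nlinarith [mul_le_mul_of_nonneg_left t1 hδ, mul_le_mul_of_nonneg_left hd hδ]

end

end Literature.MathematicalPhysics.QuantumFieldTheory.Balaban1983to89.B9Eq340NearPairBlocks
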